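import Mathlib
import Summits.KontsevichZagierPeriods.KontsevichZagierPeriods.Theorems.SoloInformedTorsionBetaLifts
import Summits.KontsevichZagierPeriods.KontsevichZagierPeriods.Theorems.SoloInformedTriplingMove
import Summits.KontsevichZagierPeriods.KontsevichZagierPeriods.Theorems.SoloInformedReflectionChains
import HarnessLib
import HarnessLib.Audit

/-!
# SoloInformed — the torsion chain, V: `⟦β(⅓,⅙)⟧ = 2 · ⟦β(⅓,½)⟧` by the three rules

**Theorem (`soloInformed_torsion_W12`).** In Kontsevich–Zagier's formal period ring,
`⟦β(⅓,⅙)⟧ = 2⟦β(⅓,½)⟧`, derived by rules 1–2 alone (additivity, change of variables; no Stokes,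
no cancellation, no `π`). The chain, with `M_κ = [(0,1), κ w^{−1/2}Q(w)^{−1/2}]` the period
`κ∫dX/y` of `E : y² = X³ + 1` in `w = 1/(X + 2)` and `σ = [3]` the tripling map:

`⟦β(⅓,⅙)⟧ = ⟦M₃|_{(0,½)}⟧`                       (lift 2, `t = X³/(X³+1)`)
`         = ⟦M₃|_{(0,¼)}⟧ + ⟦M₃|_{(¼,½)}⟧`        (rule 1 at the `2`-torsion point `w = ¼`)
`         = ⟦M₁⟧ + ⟦M₁⟧`                          (rule 2 along `σ` on each piece)
`         = 2⟦M₃|_{(½,1)}⟧`                       (rule 2 along `σ` on `(½,1)`)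
`         = 2⟦β(⅓,½)⟧`                            (lift 1, `t = −1/X³`).

Numerically `B(⅓,⅙) = 8.4131… = 2 × 4.2065… = 2B(⅓,½)`; via `Γ` this is
`Γ(⅙)Γ(⅚) = 2π = 2Γ(½)²`, a reflection-formula identity which the Beta calculus of this
residency (Dirichlet splittings + reflections, `SoloInformedReflectionChains`) reaches only
modulo the open cancellation problem `KZ.PiCancellation`; the CM torsion of `E` supplies the
missing relation without dividing by `π`. Corollaries: the swap form for `β(⅙,⅓)`, the value
identity, and — since `2 ∈ K` — membership of `⟦β(⅓,⅙)⟧` in every `K`-hull containing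
`⟦β(⅓,½)⟧`, so that the decided hull `K[⟦β(⅓,½)⟧, ⟦π⟧]` (`SoloInformedDecidedHulls`) now
decides `KZP` for `β(⅓,⅙)` as well (`soloInformed_kzp_betaThirdSixth`).
Residency `solo-KontsevichZagierPeriods-informed` (s23); paper §6octies (vii).

References: M. Kontsevich, D. Zagier, *Periods* (2001), §1.2; J. H. Silverman, *The Arithmetic
of Elliptic Curves*, III.5.1; Andrews–Askey–Roy (1999), Thm. 1.1.4, (1.1.13) (Beta symmetry),
Thm. 1.2.1 (reflection formula).
-/

noncomputable section

open MeasureTheory Set Filter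
namespace Summit.KontsevichZagierPeriods.KontsevichZagierPeriods.Theorems

open Literature.NumberTheory.Transcendental Literature.NumberTheory.Transcendental.KZ
open Literature.ModelTheory.ExponentialFields

/-! ### Rule 1 at `w = ¼` -/

/-- **Splitting the lower half at the torsion point `w = ¼`** (rule 1a + a null piece): for
any representation `R` whose domain contains `(0,½)`,
`⟦R|_{(0,½)}⟧ = ⟦R|_{(0,¼)}⟧ + ⟦R|_{(¼,½)}⟧`. [Kontsevich–Zagier 2001, §1.2, rule 1] -/
theorem soloInformed_lowerHalf_split (R : IntegralRep 1)
    (hL : {t : Fin 1 → ℝ | t 0 ∈ Ioo (0:ℝ) (1 / 2)} ⊆ R.domain)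
    (h₁ : {t : Fin 1 → ℝ | t 0 ∈ Ioo (0:ℝ) (1 / 4)} ⊆ R.domain)
    (h₂ : {t : Fin 1 → ℝ | t 0 ∈ Ioo (1 / 4 : ℝ) (1 / 2)} ⊆ R.domain) :
    toFormalPeriod (of (R.restrict _ soloInformed_isSemialgebraic_lowerHalf hL)) =
      toFormalPeriod (of (R.restrict _ soloInformed_isSemialgebraic_firstQuarter h₁)) +
        toFormalPeriod (of (R.restrict _ soloInformed_isSemialgebraic_secondQuarter h₂)) := by
  set L := R.restrict _ soloInformed_isSemialgebraic_lowerHalf hL with hLdef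
  have hE : {t : Fin 1 → ℝ | t 0 ∈ Ioo (0:ℝ) (1 / 4)} ∪
      {t : Fin 1 → ℝ | t 0 ∈ Ioo (1 / 4 : ℝ) (1 / 2)} ⊆ L.domain := by
    refine union_subset (fun x hx => ?_) (fun x hx => ?_)
    · have hx' : 0 < x 0 ∧ x 0 < 1 / 4 := hx
      exact ⟨hx'.1, by linarith [hx'.2]⟩
    · have hx' : 1 / 4 < x 0 ∧ x 0 < 1 / 2 := hx
      exact ⟨by linarith [hx'.1], hx'.2⟩
  have hEs := soloInformed_isSemialgebraic_firstQuarter.union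
    soloInformed_isSemialgebraic_secondQuarter
  -- (i) dropping the point `w = ¼` costs nothing
  have hvol : volume (L.domain \ ({t : Fin 1 → ℝ | t 0 ∈ Ioo (0:ℝ) (1 / 4)} ∪
      {t : Fin 1 → ℝ | t 0 ∈ Ioo (1 / 4 : ℝ) (1 / 2)})) = 0 := by
    refine measure_mono_null (fun x hx => ?_)
      (BallPeeling.volume_setOf_apply_eq_const 1 0 (1 / 4))
    simp only [Set.mem_sdiff, mem_union, mem_setOf_eq, mem_Ioo, not_or, not_and, not_lt] at hx
    obtain ⟨⟨h0, h1⟩, hlo', hup'⟩ := hx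
    have h2 : 1 / 4 ≤ x 0 := hlo' h0
    have h3 : x 0 ≤ 1 / 4 := by
      by_contra h
      exact absurd (hup' (not_le.mp h)) (not_le.2 h1)
    show x 0 = 1 / 4
    linarith
  have h1 := IntegralRep.of_sub_of_restrict_mem_relations L hEs hE hvol
  -- (ii) the union splits (disjoint open pieces)
  have h2 : of (L.restrict _ hEs hE) -
      of (R.restrict _ soloInformed_isSemialgebraic_firstQuarter h₁) -
        of (R.restrict _ soloInformed_isSemialgebraic_secondQuarter h₂) ∈ relations := by
    refine domainAddRel_subset_relations ⟨1, L.restrict _ hEs hE,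
      R.restrict _ soloInformed_isSemialgebraic_firstQuarter h₁,
      R.restrict _ soloInformed_isSemialgebraic_secondQuarter h₂, rfl, ?_, fun _ _ => rfl,
      fun _ _ => rfl, rfl⟩
    rw [IntegralRep.domain_restrict, IntegralRep.domain_restrict]
    have : {t : Fin 1 → ℝ | t 0 ∈ Ioo (0:ℝ) (1 / 4)} ∩
        {t : Fin 1 → ℝ | t 0 ∈ Ioo (1 / 4 : ℝ) (1 / 2)} = ∅ := by
      ext x
      simp only [mem_inter_iff, mem_setOf_eq, mem_Ioo, mem_empty_iff_false, iff_false, not_and,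
        and_imp]
      intro _ h h' _
      linarith
    rw [this, measure_empty]
  have h : of L - (of (R.restrict _ soloInformed_isSemialgebraic_firstQuarter h₁) +
      of (R.restrict _ soloInformed_isSemialgebraic_secondQuarter h₂)) ∈ relations := by
    have := relations.add_mem h1 h2
    convert this using 1
    abel
  rw [toFormalPeriod_eq_iff.mpr h, map_add]

/-! ### THEOREM: `⟦β(⅓,⅙)⟧ = 2⟦β(⅓,½)⟧` -/

/-- **THEOREM (the torsion chain).** For pinned representations `B₃₆ = β(⅓,⅙)` and
`B₃₂ = β(⅓,½)` on `(0,1)`:  `⟦β(⅓,⅙)⟧ = 2 · ⟦β(⅓,½)⟧` in Kontsevich–Zagier's formal period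
ring, DERIVED BY RULES 1–2 — both sides are pieces of the one period `∫ dX/y` on the CM curve
`y² = X³ + 1`, and the tripling map `σ = [3]` (`3 : 1` on `(0,1)`, `[3]^*ω = 3ω`) identifies
each of the three monotonicity pieces of `3∫` with `∫`. Classically `B(⅓,⅙) = 2B(⅓,½)`, i.e.
`Γ(⅙)Γ(⅚) = 2Γ(½)²`. [Kontsevich–Zagier 2001, §1.2; this work] -/
theorem soloInformed_torsion_W12 (B₃₆ B₃₂ : IntegralRep 1)
    (h36d : B₃₆.domain = {t | t 0 ∈ Ioo (0:ℝ) 1})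
    (h36i : EqOn B₃₆.integrand
      (fun t => (t 0) ^ (((1 / 3 : ℚ) : ℝ) - 1) * (1 - t 0) ^ (((1 / 6 : ℚ) : ℝ) - 1))
      B₃₆.domain)
    (h32d : B₃₂.domain = {t | t 0 ∈ Ioo (0:ℝ) 1})
    (h32i : EqOn B₃₂.integrand
      (fun t => (t 0) ^ (((1 / 3 : ℚ) : ℝ) - 1) * (1 - t 0) ^ (((1 / 2 : ℚ) : ℝ) - 1))
      B₃₂.domain) :
    toFormalPeriod (of B₃₆) = 2 * toFormalPeriod (of B₃₂) := by
  have hL : {t : Fin 1 → ℝ | t 0 ∈ Ioo (0:ℝ) (1 / 2)} ⊆ (soloInformedTorsionRep 3).domain :=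
    fun x hx => by
      have hx' : 0 < x 0 ∧ x 0 < 1 / 2 := hx
      exact ⟨hx'.1, by linarith [hx'.2]⟩
  have hU : {t : Fin 1 → ℝ | t 0 ∈ Ioo (1 / 2 : ℝ) 1} ⊆ (soloInformedTorsionRep 3).domain :=
    fun x hx => by
      have hx' : 1 / 2 < x 0 ∧ x 0 < 1 := hx
      exact ⟨by linarith [hx'.1], hx'.2⟩
  have h₁ : {t : Fin 1 → ℝ | t 0 ∈ Ioo (0:ℝ) (1 / 4)} ⊆ (soloInformedTorsionRep 3).domain :=
    fun x hx => by
      have hx' : 0 < x 0 ∧ x 0 < 1 / 4 := hx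
      exact ⟨hx'.1, by linarith [hx'.2]⟩
  have h₂ : {t : Fin 1 → ℝ | t 0 ∈ Ioo (1 / 4 : ℝ) (1 / 2)} ⊆
      (soloInformedTorsionRep 3).domain :=
    fun x hx => by
      have hx' : 1 / 4 < x 0 ∧ x 0 < 1 / 2 := hx
      exact ⟨by linarith [hx'.1], by linarith [hx'.2]⟩
  have hMi : EqOn (soloInformedTorsionRep 3).integrand (soloInformedTorsionFun 3)
      (soloInformedTorsionRep 3).domain := fun _ _ => rfl
  -- ⟦M₃|(0,½)⟧ = ⟦β(⅓,⅙)⟧ (lift 2) and ⟦M₃|(½,1)⟧ = ⟦β(⅓,½)⟧ (lift 1)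
  have e36 : toFormalPeriod (of ((soloInformedTorsionRep 3).restrict _
      soloInformed_isSemialgebraic_lowerHalf hL)) = toFormalPeriod (of B₃₆) :=
    toFormalPeriod_eq_iff.mpr (changeOfVariablesRel_subset_relations
      (soloInformed_torsion_lift₂_mem_changeOfVariablesRel _ B₃₆ rfl (fun _ _ => rfl) h36d h36i))
  have e32 : toFormalPeriod (of ((soloInformedTorsionRep 3).restrict _
      soloInformed_isSemialgebraic_upperHalf hU)) = toFormalPeriod (of B₃₂) :=
    toFormalPeriod_eq_iff.mpr (changeOfVariablesRel_subset_relations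
      (soloInformed_torsion_lift₁_mem_changeOfVariablesRel _ B₃₂ rfl (fun _ _ => rfl) h32d h32i))
  -- rule 1 at `w = ¼`, rule 2 along `σ` on the three pieces
  rw [← e36, soloInformed_lowerHalf_split _ hL h₁ h₂, soloInformed_tripling_piece₁ _ hMi h₁,
    soloInformed_tripling_piece₂ _ hMi h₂, ← e32, soloInformed_tripling_piece₃ _ hMi hU, two_mul]

/-- **Swap form**: `⟦β(⅙,⅓)⟧ = 2 · ⟦β(⅓,½)⟧` (reflection `t ↦ 1 − t`, then the torsion chain).
[this work] -/
theorem soloInformed_torsion_W12_swap (B₆₃ B₃₂ : IntegralRep 1)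
    (h63d : B₆₃.domain = {t | t 0 ∈ Ioo (0:ℝ) 1})
    (h63i : EqOn B₆₃.integrand
      (fun t => (t 0) ^ (((1 / 6 : ℚ) : ℝ) - 1) * (1 - t 0) ^ (((1 / 3 : ℚ) : ℝ) - 1))
      B₆₃.domain)
    (h32d : B₃₂.domain = {t | t 0 ∈ Ioo (0:ℝ) 1})
    (h32i : EqOn B₃₂.integrand
      (fun t => (t 0) ^ (((1 / 3 : ℚ) : ℝ) - 1) * (1 - t 0) ^ (((1 / 2 : ℚ) : ℝ) - 1))
      B₃₂.domain) :
    toFormalPeriod (of B₆₃) = 2 * toFormalPeriod (of B₃₂) := by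
  obtain ⟨B₃₆, h36d, h36i⟩ := exists_betaRep' (1 / 3) (1 / 6) (by norm_num) (by norm_num)
  rw [soloInformed_beta_swap (1 / 6) (1 / 3) B₆₃ B₃₆ h63d h63i h36d (fun x _ => by rw [h36i]),
    soloInformed_torsion_W12 B₃₆ B₃₂ h36d (fun x _ => by rw [h36i]) h32d h32i]

/-- **Value form**: `B(⅓,⅙) = 2 · B(⅓,½)` — here a COROLLARY of the moves (evaluation is a
ring homomorphism on the formal period ring). [Andrews–Askey–Roy 1999, Thm. 1.1.4; this work] -/
theorem soloInformed_torsion_W12_value (B₃₆ B₃₂ : IntegralRep 1)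
    (h36d : B₃₆.domain = {t | t 0 ∈ Ioo (0:ℝ) 1})
    (h36i : EqOn B₃₆.integrand
      (fun t => (t 0) ^ (((1 / 3 : ℚ) : ℝ) - 1) * (1 - t 0) ^ (((1 / 6 : ℚ) : ℝ) - 1))
      B₃₆.domain)
    (h32d : B₃₂.domain = {t | t 0 ∈ Ioo (0:ℝ) 1})
    (h32i : EqOn B₃₂.integrand
      (fun t => (t 0) ^ (((1 / 3 : ℚ) : ℝ) - 1) * (1 - t 0) ^ (((1 / 2 : ℚ) : ℝ) - 1))
      B₃₂.domain) :
    B₃₆.value = 2 * B₃₂.value := by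
  have h := congr_arg evalP (soloInformed_torsion_W12 B₃₆ B₃₂ h36d h36i h32d h32i)
  rwa [map_mul, evalP_toFormalPeriod_of, evalP_toFormalPeriod_of, map_ofNat] at h

/-- **`⟦β(⅓,⅙)⟧` lies in the `K`-hull of any family whose hull contains `⟦β(⅓,½)⟧`** (as
`2 ∈ K`); in particular in the decided hull `K[⟦β(⅓,½)⟧, ⟦π⟧]`. [this work] -/
theorem soloInformed_betaThirdSixth_mem_algHull (B₃₆ B₃₂ : IntegralRep 1)
    (h36d : B₃₆.domain = {t | t 0 ∈ Ioo (0:ℝ) 1})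
    (h36i : EqOn B₃₆.integrand
      (fun t => (t 0) ^ (((1 / 3 : ℚ) : ℝ) - 1) * (1 - t 0) ^ (((1 / 6 : ℚ) : ℝ) - 1))
      B₃₆.domain)
    (h32d : B₃₂.domain = {t | t 0 ∈ Ioo (0:ℝ) 1})
    (h32i : EqOn B₃₂.integrand
      (fun t => (t 0) ^ (((1 / 3 : ℚ) : ℝ) - 1) * (1 - t 0) ^ (((1 / 2 : ℚ) : ℝ) - 1))
      B₃₂.domain)
    {k : ℕ} (c : Fin k → FormalPeriodRing)
    (hB : toFormalPeriod (of B₃₂) ∈ soloInformedAlgHull c) :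
    toFormalPeriod (of B₃₆) ∈ soloInformedAlgHull c := by
  rw [soloInformed_torsion_W12 B₃₆ B₃₂ h36d h36i h32d h32i]
  exact mul_mem (ofNat_mem _ 2) hB

/-- **`KZP` decided for `β(⅓,⅙)` against the hull `K[⟦β(⅓,½)⟧, ⟦π⟧]`**: a representation with
class in that hull and the same value as `β(⅓,⅙)` is KZ-equivalent to it (combine the torsion
chain with `soloInformed_kzp_on_hull_betaThirdHalf_pi`). [this work] -/
theorem soloInformed_kzp_betaThirdSixth (B₃₆ B₃₂ : IntegralRep 1)
    (h36d : B₃₆.domain = {t | t 0 ∈ Ioo (0:ℝ) 1})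
    (h36i : EqOn B₃₆.integrand
      (fun t => (t 0) ^ (((1 / 3 : ℚ) : ℝ) - 1) * (1 - t 0) ^ (((1 / 6 : ℚ) : ℝ) - 1))
      B₃₆.domain)
    (h32d : B₃₂.domain = {t | t 0 ∈ Ioo (0:ℝ) 1})
    (h32i : EqOn B₃₂.integrand
      (fun t => (t 0) ^ (((1 / 3 : ℚ) : ℝ) - 1) * (1 - t 0) ^ (((1 / 2 : ℚ) : ℝ) - 1))
      B₃₂.domain)
    {m : ℕ} (r' : IntegralRep m)
    (hr' : toFormalPeriod (of r') ∈
      soloInformedAlgHull ![toFormalPeriod (of B₃₂), toFormalPeriod (of KZ.piRep)])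
    (hv : B₃₆.value = r'.value) : Equivalent B₃₆ r' :=
  soloInformed_kzp_on_hull_betaThirdHalf_pi B₃₂ h32d h32i B₃₆ r'
    (soloInformed_betaThirdSixth_mem_algHull B₃₆ B₃₂ h36d h36i h32d h32i _
      (soloInformed_mem_algHull_self _ 0)) hr' hv

end Summit.KontsevichZagierPeriods.KontsevichZagierPeriods.Theorems

end
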